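/-
Origin: expansion seat `planner-pub-hodgecm-prl1-g8-0`, handover prl1-g7 HANDOVER #1 2026-08-18T14:23:32Z (STATUS l.4146) md5 d96d33a4d3f07eb36ed6512aecbcb23e (NEW additive KERNEL leaf, 247 l.; imports tree HodgeCM.Automorphic.SignRecipeEndStateAllChars ONLY; NO import rewrite; nothing imports it; land in any order; LANDABLE rc 0 / 0 warnings / 0 proof-hole, axioms trio; frozen copy pub-hodgecm-prl1-g8/frozen-r31/EndStateFieldCensus.lean = pub-hodgecm-prl1-g7/handov (`HOME/pub-hodgecm-prl1-g7/lean/Prl1g7/EndStateFieldCensus.lean`, md5 d96d33a4, 247 lines);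
landed by the gen-8 packager in gate run 31 as `HodgeCM/Automorphic/EndStateFieldCensus.lean` (verbatim).
-/
/-
Copyright: pub-hodgecm formalisation cell (harness21, 2026). New file (not vendored).
Origin: HOME/pub-hodgecm-prl1-g7/lean/Prl1g7/EndStateFieldCensus.lean — session planner-pub-hodgecm-prl1-g7-0 (unit
pub-hodgecm-prl1-g7, EXPANSION PROVER a-1, gen 7, STRATEGY 1 = CONSTRUCT).  Intended final place:
`HodgeCM/Automorphic/EndStateFieldCensus.lean` (ONE NEW FILE, additive leaf; imports tree modules only; nothing imports it).
-/
import Summits.HodgeConjecture.HodgeCM.Automorphic.SignRecipeEndStateAllChars_2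

set_option autoImplicit false

/-!
# Field census of the END STATE of part (a): which datum each residual input constrains

END STATE of part (a) (run 29, `HodgeCM.Assembly.realisationExists_ofSignRecipe₇`,
`HodgeCM/Automorphic/SignRecipeEndStateAllChars.lean`):

  `RealisationExistsPerL ∧ RealisationExistsFace ⇐ M ∧ (C.thetaModel h d12 d34).AllCharsNonDesign ∧ Fact_hodgeRiemann20`

for EVERY core `C = ⟨emb, cover, wm, Theta⟩ : U.AdelicThetaCore hP` (four data), recipe bit `h : Bool` and side
data `d12 d34` (per context and side: an archimedean type `(m₁, m₂)` and an allowed-character predicate; the seven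
inputs read the archimedean types only — `SignRecipeEndStateAllChars`, `thetaModelArch`).  The seven residual inputs
are propositions about the theta model `C.thetaModel h d12 d34`, a `U.ThetaModel` record manufactured from
`(C, h, d12, d34)` by the typed carrier chain.  THIS FILE makes kernel-visible WHICH of the four data (and which side
data) each residual input actually constrains — the census that decides what a CONSTRUCTION can still buy in
STRATEGY 1 for an abstract universe `U`:

| input of `(C.thetaModel h d12 d34)` | node | constrains only | theorem |
|---|---|---|---|
| every guard `GoodCtx ι₁ c` | — | NOTHING of `C`, `d12`, `d34`: it is PerL's recipe predicate `SignRecipe.GoodCtx h ι₁ c` | `thetaModel_goodCtx_iff` |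
| `Fact_embCover` | PRINT | `emb`, `cover` | `thetaModel_embCover_iff` (explicit normal form) |
| `Fact_innerEmb` | PRINT | `emb` | `thetaModel_innerEmb_iff` (explicit normal form) |
| `Open_thetaSub` | N12 | `Theta` | `thetaModel_thetaSub_iff` (explicit normal form) |
| `Open_thetaWedge` | N33 | `Theta` | `thetaModel_thetaWedge_iff` (explicit normal form) |
| `Open_occ` | N29 | `wm`, `d12`, `d34` | `open_occ_iff_of_wm` (`emb`, `cover`, `Theta` free on both sides) |
| `Open_thetaGen12All` | N19w^all | `emb`, `wm`, `Theta`, `d12` | `open_thetaGen12All_iff` (`cover`, `d34` free) |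
| `Open_thetaReal34All` | N19g^all | `emb`, `wm`, `Theta`, `d34` | `open_thetaReal34All_iff` (`cover`, `d12` free) |

CONSEQUENCES (the honest reading, recorded here once so later cells need not re-derive it).
* `emb` (the Matsushima–Murakami map `F²H²(P_Γ) → L²([G_U])`), `cover` (level-lowering morphisms of `U`) and
  `Theta` (theta one-forms as classes of `U`) are data ABOUT the abstract universe `U`, which posits no
  uniformisation dictionary; the four inputs `embCover`, `innerEmb`, `thetaSub`, `thetaWedge` and the `emb`/`Theta`
  half of N19w^all / N19g^all are therefore INTERFACE hypotheses on `U` — no construction inside this package can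
  discharge them for an abstract `U` (GAPS.md prl1g5-K5).  Of the four data only `wm` (the adelic Weil theta models
  of the pairs `U(V) × U(W_c)`) is `U`-free, and the ONLY residual input that a constructed `wm` settles outright is
  `Open_occ` (N29) — `open_occ_iff_of_wm`: it does not see `emb`, `cover`, `Theta` at all.  The typed discharge
  interface for exactly that input from per-pair smooth linear kernel models is pv11-g9's
  `AdelicThetaCore.Open_occ_thetaModel_of_linSmoothCores` / `Assembly.perL_ofSignRecipe₀_linSmoothCores`
  (`HodgeCM/PerL34/PrintedSmoothEndState.lean`, handed for gate run 30; not imported here).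
* Every guard of every input is ONE model-free predicate on the context, `SignRecipe.GoodCtx h ι₁ c` (pair-sum,
  injectivity, `σ ∈ Ψ_i`, and the forced signs of PerL Def 3.2 computed from the recipe `κ = SignRecipe.kappa h`,
  `frameSign = SignRecipe.frameSign`); in particular the guard does not depend on the core or on the side data, so
  the seven inputs of two END STATES over different cores are comparable hypothesis by hypothesis.

No new cited fact, no new model fact, no new hypothesis; every statement is an `Iff`/`Eq` between existing named
propositions (plus the three model-free recipe predicates of §1).  PROVED; closure = {propext, Classical.choice,
Quot.sound}.
-/

noncomputable section

open scoped InnerProductSpace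
open NumberField
open Literature.AlgebraicGeometry.Motives (CMType HodgeStructure)
open Literature.AlgebraicGeometry.Motives.HodgeStructure (conj)

namespace HodgeCM

/-! ## 1. PerL's good-context predicate, model-free -/

namespace SignRecipe

/-- PerL's REQUIRED SIGN (`true` = positive) of the line of type `Ψ` at the complex embedding `τ` of `L`, for the
recipe bit `h`: `ThetaModel.reqPos` with `kappa := SignRecipe.kappa h`, `frameSign := SignRecipe.frameSign` — no
theta-model datum occurs (PerL Lemma 3.3(a), tex ll. 280–284; recipe eq:Psit ll. 61–64). -/
def reqPos (h : Bool) (K L : CMField) (j : K →+* L) (ι₁ : L →+* ℂ) (Ψ : CMType K) (τ : L →+* ℂ) : Bool :=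
  if ind Ψ (kappa h K L j ι₁ τ) = 1 then frameSign L ι₁ τ else !(frameSign L ι₁ τ)

/-- PerL's FORCED SIGNS for the recipe bit `h` (Def 3.2, tex ll. 299–304), model-free. -/
def SignsForced (h : Bool) (K L : CMField) (j : K →+* L) (ι₁ : L →+* ℂ) (Ψ : Fin 4 → CMType K)
    (D : StubTree.SeesawDatum L) : Prop :=
  ∀ (i : Fin 4) (τ : L →+* ℂ), (0 < (τ (D.a i)).re ↔ reqPos h K L j ι₁ (Ψ i) τ = true)

/-- **PerL's good-context predicate, model-free**: `ThetaModel.GoodCtx` for ANY theta model whose recipe is PerL's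
(`kappa = SignRecipe.kappa h`, `frameSign = SignRecipe.frameSign`) — pair-sum, injectivity of the four types,
`σ ∈ Ψ_i`, and `σ = ι₁ ∘ j` for some `j : K →+* L` along which the lines of `c.D` carry the forced signs. -/
structure GoodCtx (h : Bool) {L : CMField} (ι₁ : L →+* ℂ) (c : SeesawCtx L) : Prop where
  pairSum : PairSum c.Ψ
  injective : Function.Injective c.Ψ
  mem : ∀ i, c.σ ∈ (c.Ψ i).1
  forced : ∃ j : c.K →+* L, ι₁.comp j = c.σ ∧ SignsForced h c.K L j ι₁ c.Ψ c.D

end SignRecipe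

namespace Universe

open HodgeCM.Prior.Perl34File HodgeCM.Prior.Perl34File.Perl34 HodgeCM.PerL34

variable {U : Universe}

/-! ### Any theta model carrying PerL's recipe -/

namespace ThetaModel

variable (T : U.ThetaModel) (h : Bool)

/-- (Ported verbatim from the HodgeCMPerL package; no docstring in the source.) -/
theorem reqPos_eq_signRecipe (hk : T.kappa = SignRecipe.kappa h) (hf : T.frameSign = SignRecipe.frameSign) :
    T.reqPos = SignRecipe.reqPos h := by
  funext K L j ι₁ Ψ τ
  simp only [ThetaModel.reqPos, SignRecipe.reqPos, hk, hf]

/-- (Ported verbatim from the HodgeCMPerL package; no docstring in the source.) -/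
theorem signsForced_eq_signRecipe (hk : T.kappa = SignRecipe.kappa h) (hf : T.frameSign = SignRecipe.frameSign) :
    T.SignsForced = SignRecipe.SignsForced h := by
  funext K L j ι₁ Ψ D
  simp only [ThetaModel.SignsForced, SignRecipe.SignsForced, T.reqPos_eq_signRecipe h hk hf]

/-- For a theta model carrying PerL's recipe the good-context guard IS the model-free predicate. -/
theorem goodCtx_iff_signRecipe (hk : T.kappa = SignRecipe.kappa h) (hf : T.frameSign = SignRecipe.frameSign)
    {L : CMField} (ι₁ : L →+* ℂ) (c : SeesawCtx L) : T.GoodCtx ι₁ c ↔ SignRecipe.GoodCtx h ι₁ c := by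
  constructor
  · rintro ⟨h₁, h₂, h₃, j, hj, hs⟩
    exact ⟨h₁, h₂, h₃, j, hj, by rwa [T.signsForced_eq_signRecipe h hk hf] at hs⟩
  · rintro ⟨h₁, h₂, h₃, j, hj, hs⟩
    exact ⟨h₁, h₂, h₃, j, hj, by rwa [T.signsForced_eq_signRecipe h hk hf]⟩

end ThetaModel

/-! ## 2. The END STATE: guards and the four interface inputs in explicit normal form -/

namespace AdelicThetaCore

variable {hP : PrintFact_unitaryCompact} (C : U.AdelicThetaCore hP) (h : Bool)
variable (d12 d34 : ∀ {L : CMField}, SeesawCtx L → SideData L)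

/-- (Ported verbatim from the HodgeCMPerL package; no docstring in the source.) -/
theorem thetaModel_reqPos : (C.thetaModel h d12 d34).reqPos = SignRecipe.reqPos h :=
  (C.thetaModel h d12 d34).reqPos_eq_signRecipe h (C.thetaModel_kappa h d12 d34) (C.thetaModel_frameSign h d12 d34)

/-- (Ported verbatim from the HodgeCMPerL package; no docstring in the source.) -/
theorem thetaModel_signsForced : (C.thetaModel h d12 d34).SignsForced = SignRecipe.SignsForced h :=
  (C.thetaModel h d12 d34).signsForced_eq_signRecipe h (C.thetaModel_kappa h d12 d34)
    (C.thetaModel_frameSign h d12 d34)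

/-- **Every guard of the END STATE is PerL's model-free recipe predicate** — independent of the core `C` and of
the side data `d12 d34`. -/
theorem thetaModel_goodCtx_iff {L : CMField} (ι₁ : L →+* ℂ) (c : SeesawCtx L) :
    (C.thetaModel h d12 d34).GoodCtx ι₁ c ↔ SignRecipe.GoodCtx h ι₁ c :=
  (C.thetaModel h d12 d34).goodCtx_iff_signRecipe h (C.thetaModel_kappa h d12 d34)
    (C.thetaModel_frameSign h d12 d34) ι₁ c

/-- Hence the guards of two END STATES agree (any cores, any side data, same recipe bit). -/
theorem thetaModel_goodCtx_iff_thetaModel (C' : U.AdelicThetaCore hP)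
    (d12' d34' : ∀ {L : CMField}, SeesawCtx L → SideData L) {L : CMField} (ι₁ : L →+* ℂ) (c : SeesawCtx L) :
    (C.thetaModel h d12 d34).GoodCtx ι₁ c ↔ (C'.thetaModel h d12' d34').GoodCtx ι₁ c :=
  (C.thetaModel_goodCtx_iff h d12 d34 ι₁ c).trans (C'.thetaModel_goodCtx_iff h d12' d34' ι₁ c).symm

/-! ### The data of the END STATE are the data of the core (definitional unfoldings) -/

/-- (Ported verbatim from the HodgeCMPerL package; no docstring in the source.) -/
theorem thetaModel_Theta {L : CMField} {ι₁ : L →+* ℂ} (V : HermSpace3 L ι₁) (c : SeesawCtx L) (i : Fin 4)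
    (Γ : Level V) : (C.thetaModel h d12 d34).Theta V c i Γ = C.Theta V c i Γ := rfl

/-- (Ported verbatim from the HodgeCMPerL package; no docstring in the source.) -/
theorem thetaModel_emb {L : CMField} {ι₁ : L →+* ℂ} {V : HermSpace3 L ι₁} (Γ : Level V)
    (η : U.CohC (U.pms L ι₁ V Γ) 2) : (C.thetaModel h d12 d34).emb Γ η = C.emb Γ η := rfl

/-- (Ported verbatim from the HodgeCMPerL package; no docstring in the source.) -/
theorem thetaModel_cover {L : CMField} {ι₁ : L →+* ℂ} {V : HermSpace3 L ι₁} (Γ Γ' : Level V) (hle : Γ'.Γ ≤ Γ.Γ) :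
    (C.thetaModel h d12 d34).cover Γ Γ' hle = C.cover Γ Γ' hle := rfl

/-! ### The four interface inputs, explicitly: they mention `emb`, `cover`, `Theta` and the recipe bit only -/

/-- **`Fact_embCover` of the END STATE** constrains `(emb, cover)` only. -/
theorem thetaModel_embCover_iff :
    (C.thetaModel h d12 d34).Fact_embCover ↔
      ∀ {L : CMField} {ι₁ : L →+* ℂ} {V : HermSpace3 L ι₁} (Γ Γ' : Level V) (hle : Γ'.Γ ≤ Γ.Γ)
        (η : U.CohC (U.pms L ι₁ V Γ) 2), C.emb Γ' (U.pullC (C.cover Γ Γ' hle) 2 η) = C.emb Γ η :=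
  Iff.rfl

/-- **`Fact_innerEmb` of the END STATE** constrains `emb` only. -/
theorem thetaModel_innerEmb_iff :
    (C.thetaModel h d12 d34).Fact_innerEmb ↔
      ∀ {L : CMField} {ι₁ : L →+* ℂ} {V : HermSpace3 L ι₁} (Γ : Level V), ∃ a : ℂ, a ≠ 0 ∧
        ∀ η η' : U.CohC (U.pms L ι₁ V Γ) 2,
          η ∈ (U.hodge (U.pms L ι₁ V Γ) 2).F 2 → η' ∈ (U.hodge (U.pms L ι₁ V Γ) 2).F 2 →
          ⟪C.emb Γ η', C.emb Γ η⟫_ℂ = a * U.trC (U.pms L ι₁ V Γ) 4 (U.cup2C (U.pms L ι₁ V Γ) 2 η (conj η')) :=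
  Iff.rfl

/-- **`Open_thetaSub` (N12) of the END STATE** constrains `Theta` only. -/
theorem thetaModel_thetaSub_iff :
    (C.thetaModel h d12 d34).Open_thetaSub ↔
      ∀ {L : CMField} {ι₁ : L →+* ℂ} (V : HermSpace3 L ι₁) (c : SeesawCtx L), SignRecipe.GoodCtx h ι₁ c →
        ∀ (i : Fin 4) (Γ : Level V), C.Theta V c i Γ ⊆ U.Uiso Γ c.K (c.Ψ i) c.σ :=
  ⟨fun H _ ι₁ V c hc => H V c ((C.thetaModel_goodCtx_iff h d12 d34 ι₁ c).mpr hc),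
    fun H _ ι₁ V c hc => H V c ((C.thetaModel_goodCtx_iff h d12 d34 ι₁ c).mp hc)⟩

/-- **`Open_thetaWedge` (N33) of the END STATE** constrains `Theta` only. -/
theorem thetaModel_thetaWedge_iff :
    (C.thetaModel h d12 d34).Open_thetaWedge ↔
      ∀ {L : CMField} {ι₁ : L →+* ℂ} (V : HermSpace3 L ι₁) (c : SeesawCtx L), SignRecipe.GoodCtx h ι₁ c →
        ∃ Γ : Level V, ∃ ω₁ ∈ C.Theta V c 0 Γ, ∃ ω₂ ∈ C.Theta V c 1 Γ, U.cup2C (U.pms L ι₁ V Γ) 1 ω₁ ω₂ ≠ 0 :=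
  ⟨fun H _ ι₁ V c hc => H V c ((C.thetaModel_goodCtx_iff h d12 d34 ι₁ c).mpr hc),
    fun H _ ι₁ V c hc => H V c ((C.thetaModel_goodCtx_iff h d12 d34 ι₁ c).mp hc)⟩

end AdelicThetaCore

/-! ## 3. The three torus-side inputs: which data they do NOT see

Stated as invariance under replacing the unseen data by arbitrary other data (shared variables = the data seen). -/

namespace AdelicThetaCore

variable {hP : PrintFact_unitaryCompact} (h : Bool)
variable (emb emb' : ∀ {L : CMField} {ι₁ : L →+* ℂ} {V : HermSpace3 L ι₁} (Γ : Level V),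
  U.CohC (U.pms L ι₁ V Γ) 2 →ₗ[ℂ] (V.latticeModel hP).toQuotientModel.H)
variable (cover cover' : ∀ {L : CMField} {ι₁ : L →+* ℂ} {V : HermSpace3 L ι₁} (Γ Γ' : Level V),
  Γ'.Γ ≤ Γ.Γ → U.Mor (U.pms L ι₁ V Γ') (U.pms L ι₁ V Γ))
variable (wm : ∀ {L : CMField} {ι₁ : L →+* ℂ} (V : HermSpace3 L ι₁) (c : SeesawCtx L),
  WeilThetaModel (V.latticeModel hP).toQuotientModel.G (V.latticeModel hP).toQuotientModel.Γ
    (c.D.latticeModelW hP).toQuotientModel.G (c.D.latticeModelW hP).toQuotientModel.Γ)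
variable (Theta Theta' : ∀ {L : CMField} {ι₁ : L →+* ℂ} (V : HermSpace3 L ι₁), SeesawCtx L → Fin 4 →
  ∀ Γ : Level V, Set (U.CohC (U.pms L ι₁ V Γ) 1))
variable (d12 d34 d12' d34' : ∀ {L : CMField}, SeesawCtx L → SideData L)

/-- **`Open_occ` (N29) of the END STATE does not see `emb`, `cover`, `Theta`**: it constrains the Weil theta
models `wm` (and reads the side data) only.  This is the one residual input a CONSTRUCTED `wm` settles outright. -/
theorem open_occ_iff_of_wm :
    ((⟨@emb, @cover, @wm, @Theta⟩ : U.AdelicThetaCore hP).thetaModel h d12 d34).Open_occ ↔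
      ((⟨@emb', @cover', @wm, @Theta'⟩ : U.AdelicThetaCore hP).thetaModel h d12 d34).Open_occ :=
  ⟨fun H _ ι₁ V c hc => H V c ((thetaModel_goodCtx_iff_thetaModel _ h d12 d34 _ d12 d34 ι₁ c).mpr hc),
    fun H _ ι₁ V c hc => H V c ((thetaModel_goodCtx_iff_thetaModel _ h d12 d34 _ d12 d34 ι₁ c).mpr hc)⟩

/-- **`Open_thetaGen12All` (N19w^all) does not see `cover` nor the (34) side data.** -/
theorem open_thetaGen12All_iff :
    ((⟨@emb, @cover, @wm, @Theta⟩ : U.AdelicThetaCore hP).thetaModel h d12 d34).Open_thetaGen12All ↔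
      ((⟨@emb, @cover', @wm, @Theta⟩ : U.AdelicThetaCore hP).thetaModel h d12 d34').Open_thetaGen12All :=
  ⟨fun H _ ι₁ V c hc => H V c ((thetaModel_goodCtx_iff_thetaModel _ h d12 d34 _ d12 d34' ι₁ c).mpr hc),
    fun H _ ι₁ V c hc => H V c ((thetaModel_goodCtx_iff_thetaModel _ h d12 d34' _ d12 d34 ι₁ c).mpr hc)⟩

/-- **`Open_thetaReal34All` (N19g^all) does not see `cover` nor the (12) side data.** -/
theorem open_thetaReal34All_iff :
    ((⟨@emb, @cover, @wm, @Theta⟩ : U.AdelicThetaCore hP).thetaModel h d12 d34).Open_thetaReal34All ↔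
      ((⟨@emb, @cover', @wm, @Theta⟩ : U.AdelicThetaCore hP).thetaModel h d12' d34).Open_thetaReal34All :=
  ⟨fun H _ ι₁ V c hc => H V c ((thetaModel_goodCtx_iff_thetaModel _ h d12 d34 _ d12' d34 ι₁ c).mpr hc),
    fun H _ ι₁ V c hc => H V c ((thetaModel_goodCtx_iff_thetaModel _ h d12' d34 _ d12 d34 ι₁ c).mpr hc)⟩

end AdelicThetaCore

end Universe

end HodgeCM

end
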